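import Literature.AlgebraicGeometry.Motives.HodgeLieWeightOneRankTwelveLeviFour
import Mathlib.LinearAlgebra.BilinearForm.Orthogonal
import HarnessLib

/-!
# Weight one: NILPOTENT COMPRESSION and the rank of the corners `E𝔏(1−E)`, `(1−E)𝔏E` of the Levi algebra of a
# minimal raising tripotent — a corner element of rank `≤ 2` has rank `≤ 1` when the minimal rank is `≥ 3`
# (brick R1 of the `r = 3` leg of the rank-twelve crux; Deligne I §3, Moonen–Zarhin 1999 (2.3)–(2.5); classification-free)

Family `hodge`, layer `Literature/AlgebraicGeometry/Motives`; THEOREMS ONLY (no definition, no named fact; D-0026).  Written for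
the cell `pub-hodgeav-hg6` (LADDER-HodgeAV row 2, TABLE X row 1 `g6.I(1)`: the `r = 3` return leg of `RankTwelveSimpleCrux34` after
`rankTwelve_sp_or_leviCore33`; eng-2 lineage g5; honest framing: HC / HC_AV / HC_CM NOT proved — unconditional Hodge–Lie linear
algebra).

SETTING.  `H` effective polarized of weight `1`, `P = V^{1,0}`, `Q = V^{0,1}`, `𝔥_ℂ = Lie Hg ⊗ ℂ`; a raising `B` whose rank is
minimal among the non-zero raising operators (hypothesis `hmin`).  A LEVI element is `Z ∈ 𝔥_ℂ` with `Z P ⊆ P`, `Z Q ⊆ Q`.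

WHAT IS PROVED.
* §1 **`NilCompression.mul_mul_mul_mem`** (abstract: `Z ∈ 𝔊`, `Z² = 0` ⟹ `Z x Z = −½[Z,[Z,x]] ∈ 𝔊`);
  **`NilCompression.sq_eq_zero_of_levi`** (a Levi `Z` with `Z² = 0` on `P` has `Z² = 0`, by `ψ_ℂ`-duality);
  **`NilCompression.compression_lowering_mem`** (then `Z z Z ∈ 𝔥⁻` for lowering `z`).
* §2 **`finrank_range_conjOp_le`** (`rank ȳ ≤ rank y` for `ȳ = conj ∘ y ∘ conj`) and
  **`WeightOnePeirce.lowering_eq_zero_of_finrank_lt`** (a lowering element of rank below the minimal raising rank vanishes).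
* §3 **`WeightOnePeirce.form_lowering_symm`** (`ψ_ℂ(z p, p′)` is symmetric on `P` for lowering `z`) and
  **`WeightOnePeirce.corner_finrank_le_one`** — THE CORNER LEMMA: if `z ∈ 𝔥⁻` and a `3`-dimensional `U₀ ⊆ P` carry a
  non-degenerate `ψ_ℂ(z ·, ·)|_{U₀}`, the minimal raising rank is `≥ 3`, and a Levi `Z` with `Z² = 0` on `P` maps `P` into `U₀` with
  `dim Z(P) ≤ 2`, then `dim Z(P) ≤ 1` (`Z z Z ∈ 𝔥⁻` has rank `≤ 2 < 3`, hence vanishes, so `Z(P)` is `ψ_ℂ(z·,·)`-isotropic in `U₀`;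
  `2·dim ≤ 3`).
* §4 **`WeightOnePeirce.form_conjOp_nondegenerate_on_range`** — for the minimal tripotent `B` (`B B̄ B = tB`) the form
  `ψ_ℂ(B̄ u, u′)` is non-degenerate on `U = range B`; hence **`WeightOnePeirce.upperCorner_finrank_le_one`**: a Levi `Z` killing
  `range B` with `Z(P) ⊆ range B`, `dim Z(P) ≤ 2`, `rank B = 3`, has `dim Z(P) ≤ 1` (the corner `E𝔏(1 − E)`; the opposite corner
  follows from §3 with the transported form, in the sequel).

## References

* [Deligne1982HodgeCycles] P. Deligne, *Hodge cycles on abelian varieties*, LNM 900 (1982), I §3 (Prop. 3.4, 3.6).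
* [MoonenZarhin1999LowDim] B. Moonen, Yu. Zarhin, *Hodge classes on abelian varieties of low dimension*, Math. Ann. 315 (1999),
  §2 (2.3)–(2.5).
* [HoffmanKunze1971LinearAlgebra] K. Hoffman, R. Kunze, *Linear Algebra* (1971), §10.2 (isotropic subspaces of symmetric forms).
-/

noncomputable section

open scoped TensorProduct

open Module

namespace Literature.AlgebraicGeometry.Motives

namespace HodgeStructure

universe u

/-! ## §1 Nilpotent compression -/

/-- **Nilpotent compression (abstract).**  `𝔊 ⊆ End(M)` bracket-closed, `Z ∈ 𝔊` with `Z² = 0`, `x ∈ 𝔊`: then `Z x Z ∈ 𝔊`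
(`[Z,[Z,x]] = Z²x − 2ZxZ + xZ² = −2ZxZ`). [cite: Deligne1982HodgeCycles, I §3 (proof of Prop. 3.4)]
[cite: MoonenZarhin1999LowDim, §2 (2.3)] -/
theorem NilCompression.mul_mul_mul_mem {M : Type*} [AddCommGroup M] [Module ℂ M] {𝔊 : Submodule ℂ (Module.End ℂ M)}
    (hbr : ∀ Y ∈ 𝔊, ∀ Z ∈ 𝔊, Y * Z - Z * Y ∈ 𝔊) {Z : Module.End ℂ M} (hZ : Z ∈ 𝔊) (hZZ : Z * Z = 0)
    {x : Module.End ℂ M} (hx : x ∈ 𝔊) : Z * x * Z ∈ 𝔊 := by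
  have hD : Z * x - x * Z ∈ 𝔊 := hbr Z hZ x hx
  have hD₂ : Z * (Z * x - x * Z) - (Z * x - x * Z) * Z ∈ 𝔊 := hbr Z hZ _ hD
  have key : Z * (Z * x - x * Z) - (Z * x - x * Z) * Z = (-2 : ℂ) • (Z * x * Z) := by
    rw [mul_sub, sub_mul, ← mul_assoc, hZZ, zero_mul, zero_sub, mul_assoc x Z Z, hZZ, mul_zero, sub_zero, ← mul_assoc,
      neg_smul, two_smul]
    abel
  rw [key] at hD₂
  exact (Submodule.smul_mem_iff _ (by norm_num)).1 hD₂

variable {V : Type u} [AddCommGroup V] [Module ℚ V] [Module.Finite ℚ V] [HodgeTensorFacts.{u, u}] {n : ℤ}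

set_option maxHeartbeats 800000 in
/-- **A Levi element with `Z² = 0` on `P` has `Z² = 0`** (`ψ_ℂ(Z²q, p) = ψ_ℂ(q, Z²p) = 0`, `Q` isotropic, `ψ_ℂ` non-degenerate).
[cite: Deligne1982HodgeCycles, I §3 Prop. 3.4] [cite: MoonenZarhin1999LowDim, §2 (2.3)] -/
theorem NilCompression.sq_eq_zero_of_levi (H : HodgeStructure V n) (ψ : H.Polarization) (hn : n = 1)
    (heff : H.IsEffective) {Z : Module.End ℂ (ℂ ⊗[ℚ] V)} (hZ : Z ∈ H.hodgeLieC)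
    (hZP : ∀ p ∈ H.piece 1 0, Z p ∈ H.piece 1 0) (hZQ : ∀ q ∈ H.piece 0 1, Z q ∈ H.piece 0 1)
    (hZZ : ∀ p ∈ H.piece 1 0, Z (Z p) = 0) : Z * Z = 0 := by
  obtain ⟨-, -, -, Θ, hΘ, -⟩ := hodgeLie_standing H ψ
  subst hn
  obtain ⟨hPmem, hQmem, -, -, -⟩ := UnitaryTheta.theta_facts H rfl heff hΘ
  set ω := ψ.form.baseChange ℂ with hω
  have hωnd : ω.Nondegenerate := by rw [hω]; exact ψ.nondegenerate_baseChange
  have hskew : ∀ a b, ω (Z a) b = -ω a (Z b) := fun a b => by rw [hω]; exact formBaseChange_skew_of_mem_hodgeLieC ψ hZ a b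
  have hQQ : ∀ q ∈ H.piece 0 1, ∀ q' ∈ H.piece 0 1, ω q q' = 0 := fun q hq q' hq' =>
    ψ.form_piece_piece (p := 0) (p' := 0) (by norm_num) (by simpa using hq) (by simpa using hq')
  have hvdec : ∀ v : ℂ ⊗[ℚ] V, (2 : ℂ)⁻¹ • (v + Θ v) + (2 : ℂ)⁻¹ • (v - Θ v) = v := fun v => by module
  have hZZQ : ∀ q ∈ H.piece 0 1, Z (Z q) = 0 := by
    intro q hq
    have hu : Z (Z q) ∈ H.piece 0 1 := hZQ _ (hZQ q hq)
    refine hωnd.1 _ fun w => ?_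
    rw [← hvdec w, map_add, hQQ _ hu _ (hQmem w), add_zero, hskew, hskew, neg_neg, hZZ _ (hPmem w), map_zero]
  refine LinearMap.ext fun v => ?_
  rw [Module.End.mul_apply, LinearMap.zero_apply, ← hvdec v, map_add, map_add, hZZ _ (hPmem v), hZZQ _ (hQmem v), add_zero]

set_option maxHeartbeats 800000 in
/-- **Nilpotent compression of a lowering operator.**  Levi `Z ∈ 𝔥_ℂ` with `Z² = 0` on `P`, `z ∈ 𝔥_ℂ` lowering: `Z z Z ∈ 𝔥_ℂ` is
lowering. [cite: Deligne1982HodgeCycles, I §3 (proof of Prop. 3.4)] [cite: MoonenZarhin1999LowDim, §2 (2.3)] -/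
theorem NilCompression.compression_lowering_mem (H : HodgeStructure V n) (ψ : H.Polarization) (hn : n = 1)
    (heff : H.IsEffective) {Z : Module.End ℂ (ℂ ⊗[ℚ] V)} (hZ : Z ∈ H.hodgeLieC)
    (hZP : ∀ p ∈ H.piece 1 0, Z p ∈ H.piece 1 0) (hZQ : ∀ q ∈ H.piece 0 1, Z q ∈ H.piece 0 1)
    (hZZ : ∀ p ∈ H.piece 1 0, Z (Z p) = 0) {z : Module.End ℂ (ℂ ⊗[ℚ] V)} (hz : z ∈ H.hodgeLieC)
    (hzQ : ∀ q ∈ H.piece 0 1, z q = 0) (hzim : ∀ v, z v ∈ H.piece 0 1) :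
    Z * z * Z ∈ H.hodgeLieC ∧ (∀ q ∈ H.piece 0 1, (Z * z * Z) q = 0) ∧ (∀ v, (Z * z * Z) v ∈ H.piece 0 1) := by
  obtain ⟨hbr, -, -, -, -, -⟩ := hodgeLie_standing H ψ
  have hspan : H.hodgeLieC = spanC H.hodgeLie := hodgeLieC_eq_spanC H
  have hbrC : ∀ Y ∈ H.hodgeLieC, ∀ Y' ∈ H.hodgeLieC, Y * Y' - Y' * Y ∈ H.hodgeLieC := fun Y hY Y' hY' => by
    rw [hspan] at hY hY' ⊢
    exact commutator_mem_spanC hbr hY hY'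
  have hZZ' := NilCompression.sq_eq_zero_of_levi H ψ hn heff hZ hZP hZQ hZZ
  refine ⟨NilCompression.mul_mul_mul_mem hbrC hZ hZZ' hz, fun q hq => ?_, fun v => ?_⟩
  · rw [Module.End.mul_apply, Module.End.mul_apply, hzQ _ (hZQ q hq), map_zero]
  · rw [Module.End.mul_apply, Module.End.mul_apply]
    exact hZQ _ (hzim _)

/-! ## §2 Rank transport under conjugation -/

omit [Module.Finite ℚ V] [HodgeTensorFacts.{u, u}] in
/-- **`rank(conj ∘ y ∘ conj) ≤ rank y`**: the conjugate of a basis of `range y` spans `range ȳ`.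
[cite: Deligne1982HodgeCycles, I §3] -/
theorem finrank_range_conjOp_le {y yb : Module.End ℂ (ℂ ⊗[ℚ] V)} (hyb : ∀ v, yb v = conj (y (conj v)))
    [FiniteDimensional ℂ ↥(LinearMap.range y)] :
    Module.finrank ℂ (LinearMap.range yb) ≤ Module.finrank ℂ (LinearMap.range y) := by
  classical
  set k := Module.finrank ℂ (LinearMap.range y)
  let b : Module.Basis (Fin k) ℂ ↥(LinearMap.range y) := Module.finBasis ℂ _
  let c : Fin k → ℂ ⊗[ℚ] V := fun i => conj ((b i : ↥(LinearMap.range y)) : ℂ ⊗[ℚ] V)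
  have hle : LinearMap.range yb ≤ Submodule.span ℂ (Set.range c) := by
    rintro _ ⟨v, rfl⟩
    rw [hyb]
    have hmem : y (conj v) ∈ LinearMap.range y := LinearMap.mem_range_self y _
    have hrepr := b.sum_repr ⟨y (conj v), hmem⟩
    have hval : y (conj v) = ∑ i, (b.repr ⟨y (conj v), hmem⟩ i) • ((b i : ↥(LinearMap.range y)) : ℂ ⊗[ℚ] V) := by
      have h := congrArg Subtype.val hrepr
      simp only [Submodule.coe_sum, Submodule.coe_smul] at h
      exact h.symm
    rw [hval, map_sum]
    refine Submodule.sum_mem _ fun i _ => ?_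
    rw [conj_smul]
    exact Submodule.smul_mem _ _ (Submodule.subset_span ⟨i, rfl⟩)
  haveI : Module.Finite ℂ ↥(Submodule.span ℂ (Set.range c)) := Module.Finite.span_of_finite ℂ (Set.finite_range c)
  calc Module.finrank ℂ (LinearMap.range yb) ≤ Module.finrank ℂ (Submodule.span ℂ (Set.range c)) :=
        Submodule.finrank_mono hle
    _ ≤ Fintype.card (Fin k) := finrank_range_le_card c
    _ = k := Fintype.card_fin k

set_option maxHeartbeats 800000 in
/-- **A lowering element of rank below the minimal raising rank vanishes**: its conjugate is a raising element of `𝔥_ℂ` of no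
larger rank. [cite: Deligne1982HodgeCycles, I §3 Prop. 3.4] [cite: MoonenZarhin1999LowDim, §2 (2.3)] -/
theorem WeightOnePeirce.lowering_eq_zero_of_finrank_lt (H : HodgeStructure V n) (hn : n = 1)
    {B : Module.End ℂ (ℂ ⊗[ℚ] V)}
    (hmin : ∀ B' ∈ H.hodgeLieC, B' ≠ 0 → (∀ p ∈ H.piece 1 0, B' p = 0) → (∀ v, B' v ∈ H.piece 1 0) →
      Module.finrank ℂ (LinearMap.range B) ≤ Module.finrank ℂ (LinearMap.range B'))
    {y : Module.End ℂ (ℂ ⊗[ℚ] V)} (hy : y ∈ H.hodgeLieC) (hyQ : ∀ q ∈ H.piece 0 1, y q = 0)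
    (hyim : ∀ v, y v ∈ H.piece 0 1)
    (hlt : Module.finrank ℂ (LinearMap.range y) < Module.finrank ℂ (LinearMap.range B)) : y = 0 := by
  classical
  by_contra hy0
  have hspan : H.hodgeLieC = spanC H.hodgeLie := hodgeLieC_eq_spanC H
  obtain ⟨yb, hyb⟩ := exists_conjOp y
  have hyb𝔥 : yb ∈ H.hodgeLieC := by
    rw [hspan] at hy ⊢
    exact conjOp_mem_spanC hy hyb
  subst hn
  have hybP : ∀ p ∈ H.piece 1 0, yb p = 0 := fun p hp => by
    rw [hyb, hyQ _ (conj_mem_piece H hp), map_zero]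
  have hybim : ∀ v, yb v ∈ H.piece 1 0 := fun v => by
    rw [hyb]
    exact conj_mem_piece H (hyim _)
  have hyb0 : yb ≠ 0 := by
    intro h
    apply hy0
    refine LinearMap.ext fun v => ?_
    have e := hyb (conj v)
    rw [h, LinearMap.zero_apply, conj_conj] at e
    have e' := congrArg conj e
    rw [map_zero, conj_conj] at e'
    rw [LinearMap.zero_apply]
    exact e'.symm
  have hrk := finrank_range_conjOp_le hyb
  have h := hmin yb hyb𝔥 hyb0 hybP hybim
  omega

/-! ## §3 The corner lemma -/

/-- **`ψ_ℂ(z p, p′)` is symmetric in `p, p′`** for `z ∈ 𝔥_ℂ` (skewness and oddness of `ψ_ℂ`).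
[cite: Deligne1982HodgeCycles, I §3] -/
theorem WeightOnePeirce.form_lowering_symm (H : HodgeStructure V n) (ψ : H.Polarization) (hn : n = 1)
    {z : Module.End ℂ (ℂ ⊗[ℚ] V)} (hz : z ∈ H.hodgeLieC) (a b : ℂ ⊗[ℚ] V) :
    ψ.form.baseChange ℂ (z a) b = ψ.form.baseChange ℂ (z b) a := by
  subst hn
  rw [formBaseChange_skew_of_mem_hodgeLieC ψ hz a b, form_baseChange_swap_of_odd H odd_one ψ (z b) a, neg_neg]

set_option maxHeartbeats 3200000 in
/-- **THE CORNER LEMMA.**  `H` effective polarized of weight `1`; the minimal raising rank is `≥ 3` (`B` of minimal rank,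
`3 ≤ rank B`); `z ∈ 𝔥_ℂ` lowering; `U₀ ⊆ P` of dimension `3` on which `ψ_ℂ(z ·, ·)` is non-degenerate; `Z ∈ 𝔥_ℂ` Levi with
`Z² = 0` on `P`, `Z(P) ⊆ U₀`.  If `dim Z(P) ≤ 2` then `dim Z(P) ≤ 1`.  PROOF: `Z z Z ∈ 𝔥⁻` (nilpotent compression) has rank
`≤ dim Z(P) ≤ 2 < 3`, so it vanishes (`lowering_eq_zero_of_finrank_lt`); hence `ψ_ℂ(z Zp, Zp′) = 0`, i.e. `Z(P)` is totally
isotropic in `(U₀, ψ_ℂ(z·,·))`, and `2·dim Z(P) ≤ 3`. [cite: MoonenZarhin1999LowDim, §2 (2.3)–(2.5)]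
[cite: Deligne1982HodgeCycles, I §3 Prop. 3.4, Prop. 3.6] [cite: HoffmanKunze1971LinearAlgebra, §10.2] -/
theorem WeightOnePeirce.corner_finrank_le_one (H : HodgeStructure V n) (ψ : H.Polarization) (hn : n = 1)
    (heff : H.IsEffective) {B : Module.End ℂ (ℂ ⊗[ℚ] V)}
    (hmin : ∀ B' ∈ H.hodgeLieC, B' ≠ 0 → (∀ p ∈ H.piece 1 0, B' p = 0) → (∀ v, B' v ∈ H.piece 1 0) →
      Module.finrank ℂ (LinearMap.range B) ≤ Module.finrank ℂ (LinearMap.range B'))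
    (h3 : 3 ≤ Module.finrank ℂ (LinearMap.range B))
    {z : Module.End ℂ (ℂ ⊗[ℚ] V)} (hz : z ∈ H.hodgeLieC) (hzQ : ∀ q ∈ H.piece 0 1, z q = 0)
    (hzim : ∀ v, z v ∈ H.piece 0 1)
    {U₀ : Submodule ℂ (ℂ ⊗[ℚ] V)} (hU₀3 : Module.finrank ℂ U₀ = 3)
    (hnd : ∀ u ∈ U₀, (∀ u' ∈ U₀, ψ.form.baseChange ℂ (z u) u' = 0) → u = 0)
    {Z : Module.End ℂ (ℂ ⊗[ℚ] V)} (hZ : Z ∈ H.hodgeLieC) (hZP : ∀ p ∈ H.piece 1 0, Z p ∈ H.piece 1 0)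
    (hZQ : ∀ q ∈ H.piece 0 1, Z q ∈ H.piece 0 1) (hZZ : ∀ p ∈ H.piece 1 0, Z (Z p) = 0)
    (hZU₀ : ∀ p ∈ H.piece 1 0, Z p ∈ U₀)
    (hk : Module.finrank ℂ ((H.piece 1 0).map Z) ≤ 2) : Module.finrank ℂ ((H.piece 1 0).map Z) ≤ 1 := by
  classical
  obtain ⟨-, -, -, Θ, hΘ, -⟩ := hodgeLie_standing H ψ
  obtain ⟨hy, hyQ, hyim⟩ := NilCompression.compression_lowering_mem H ψ hn heff hZ hZP hZQ hZZ hz hzQ hzim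
  subst hn
  obtain ⟨hPmem, hQmem, -, -, -⟩ := UnitaryTheta.theta_facts H rfl heff hΘ
  have hvdec : ∀ v : ℂ ⊗[ℚ] V, (2 : ℂ)⁻¹ • (v + Θ v) + (2 : ℂ)⁻¹ • (v - Θ v) = v := fun v => by module
  set ω := ψ.form.baseChange ℂ with hω
  set W := (H.piece 1 0).map Z with hWdef
  -- the compression `Z z Z` has rank `≤ dim Z(P) ≤ 2`, hence vanishes
  have hrange : LinearMap.range (Z * z * Z) ≤ W.map (Z * z) := by
    rintro _ ⟨v, rfl⟩
    have hv : (Z * z * Z) v = (Z * z) (Z ((2 : ℂ)⁻¹ • (v + Θ v))) := by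
      conv_lhs => rw [← hvdec v]
      rw [Module.End.mul_apply, Module.End.mul_apply, map_add, map_add, hzQ _ (hZQ _ (hQmem v)), add_zero,
        Module.End.mul_apply]
    rw [hv]
    exact Submodule.mem_map_of_mem (Submodule.mem_map_of_mem (hPmem v))
  have hrk : Module.finrank ℂ (LinearMap.range (Z * z * Z)) ≤ 2 :=
    (Submodule.finrank_mono hrange).trans ((Submodule.finrank_map_le _ _).trans hk)
  have hy0 : Z * z * Z = 0 :=
    WeightOnePeirce.lowering_eq_zero_of_finrank_lt H rfl hmin hy hyQ hyim (by omega)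
  -- isotropy of `Z(P)`
  have hskew : ∀ a b, ω (Z a) b = -ω a (Z b) := fun a b => by rw [hω]; exact formBaseChange_skew_of_mem_hodgeLieC ψ hZ a b
  have hiso : ∀ p ∈ H.piece 1 0, ∀ p' ∈ H.piece 1 0, ω (z (Z p)) (Z p') = 0 := by
    intro p _ p' _
    have h := congrArg (fun Y : Module.End ℂ (ℂ ⊗[ℚ] V) => ω (Y p) p') hy0
    simp only [Module.End.mul_apply, LinearMap.zero_apply, map_zero, LinearMap.zero_apply, hskew, neg_eq_zero] at h
    exact h
  -- the symmetric form `β(u, u′) = ψ_ℂ(z u, u′)` on `U₀`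
  let β : LinearMap.BilinForm ℂ ↥U₀ := ω.compl₁₂ (z ∘ₗ U₀.subtype) U₀.subtype
  have hβv : ∀ u u' : ↥U₀, β u u' = ω (z u) u' := fun _ _ => rfl
  have hβsymm : ∀ u u' : ↥U₀, β u u' = β u' u := fun u u' => by
    rw [hβv, hβv, hω]
    exact WeightOnePeirce.form_lowering_symm H ψ rfl hz _ _
  have hβnd : β.Nondegenerate := by
    refine ⟨fun u hu => ?_, fun u hu => ?_⟩
    · exact Subtype.ext (hnd _ u.2 fun u' hu' => by have h := hu ⟨u', hu'⟩; rwa [hβv] at h)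
    · exact Subtype.ext (hnd _ u.2 fun u' hu' => by have h := hu ⟨u', hu'⟩; rwa [hβsymm, hβv] at h)
  -- `Z(P)` viewed inside `U₀`
  have hWle : W ≤ U₀ := by
    rintro _ ⟨p, hp, rfl⟩
    exact hZU₀ p hp
  set W' : Submodule ℂ ↥U₀ := W.comap U₀.subtype with hW'def
  have hfin : Module.finrank ℂ W' = Module.finrank ℂ W := (Submodule.comapSubtypeEquivOfLe hWle).finrank_eq
  have hW'iso : W' ≤ β.orthogonal W' := by
    intro w hw
    rw [LinearMap.BilinForm.mem_orthogonal_iff]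
    intro w' hw'
    rw [hβv]
    obtain ⟨p, hp, hpw⟩ := Submodule.mem_map.1 (Submodule.mem_comap.1 hw)
    obtain ⟨p', hp', hp'w'⟩ := Submodule.mem_map.1 (Submodule.mem_comap.1 hw')
    rw [show ((w : ↥U₀) : ℂ ⊗[ℚ] V) = Z p from hpw.symm, show ((w' : ↥U₀) : ℂ ⊗[ℚ] V) = Z p' from hp'w'.symm]
    exact hiso p' hp' p hp
  have horth := LinearMap.BilinForm.finrank_orthogonal hβnd W'
  have hU₀3' : Module.finrank ℂ ↥U₀ = 3 := hU₀3
  have hle := Submodule.finrank_mono hW'iso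
  rw [horth, hU₀3'] at hle
  omega

/-! ## §4 The upper corner of the minimal tripotent -/

set_option maxHeartbeats 3200000 in
/-- **`ψ_ℂ(B̄ u, u′)` is non-degenerate on `U = range B`** for a minimal raising tripotent `B` (`B B̄ B = tB`, `t ≠ 0`:
`ψ_ℂ(B̄u, Bw) = −t ψ_ℂ(u, w)`). [cite: Deligne1982HodgeCycles, I §3 Prop. 3.4, Prop. 3.6] [cite: MoonenZarhin1999LowDim, §2 (2.5)] -/
theorem WeightOnePeirce.form_conjOp_nondegenerate_on_range (H : HodgeStructure V n) (ψ : H.Polarization) (hn : n = 1)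
    (heff : H.IsEffective)
    {B C : Module.End ℂ (ℂ ⊗[ℚ] V)} (hB : B ∈ H.hodgeLieC) (hB0 : B ≠ 0) (hBP : ∀ p ∈ H.piece 1 0, B p = 0)
    (hBim : ∀ v, B v ∈ H.piece 1 0) (hC : ∀ v, C v = conj (B (conj v)))
    (hmin : ∀ B' ∈ H.hodgeLieC, B' ≠ 0 → (∀ p ∈ H.piece 1 0, B' p = 0) → (∀ v, B' v ∈ H.piece 1 0) →
      Module.finrank ℂ (LinearMap.range B) ≤ Module.finrank ℂ (LinearMap.range B')) :
    ∀ u ∈ LinearMap.range B, (∀ u' ∈ LinearMap.range B, ψ.form.baseChange ℂ (C u) u' = 0) → u = 0 := by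
  classical
  obtain ⟨hbr, -, -, Θ, hΘ, hΘ𝔤⟩ := hodgeLie_standing H ψ
  have hspan : H.hodgeLieC = spanC H.hodgeLie := hodgeLieC_eq_spanC H
  have hΘC : Θ ∈ H.hodgeLieC := by rw [hspan]; exact hΘ𝔤
  have hbrC : ∀ Y ∈ H.hodgeLieC, ∀ Y' ∈ H.hodgeLieC, Y * Y' - Y' * Y ∈ H.hodgeLieC := fun Y hY Y' hY' => by
    rw [hspan] at hY hY' ⊢
    exact commutator_mem_spanC hbr hY hY'
  have hC𝔊 : C ∈ H.hodgeLieC := by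
    rw [hspan] at hB ⊢
    exact conjOp_mem_spanC hB hC
  obtain ⟨t, ht, hBCB⟩ :=
    WeightOneMinimalRaising.mul_conjOp_mul_eq_smul H ψ hn heff hΘ le_rfl hbrC hB hB0 hBP hBim hC hC𝔊 hmin
  subst hn
  set ω := ψ.form.baseChange ℂ with hω
  have hωnd : ω.Nondegenerate := by rw [hω]; exact ψ.nondegenerate_baseChange
  have hskewB : ∀ a b, ω (B a) b = -ω a (B b) := fun a b => by
    rw [hω]; exact formBaseChange_skew_of_mem_hodgeLieC ψ hB a b
  rintro _ ⟨w₀, rfl⟩ hu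
  -- `ψ_ℂ(C B w₀, B w) = −ψ_ℂ(B C B w₀, w) = −t ψ_ℂ(B w₀, w) = 0` for all `w`
  have hzero : ∀ w, ω (B w₀) w = 0 := by
    intro w
    have h := hu (B w) (LinearMap.mem_range_self B w)
    have h' : ω ((B * C * B) w₀) w = 0 := by
      have e : ω ((B * C * B) w₀) w = -ω (C (B w₀)) (B w) := by
        rw [Module.End.mul_apply, Module.End.mul_apply, hskewB]
      rw [e, h, neg_zero]
    rw [hBCB, LinearMap.smul_apply, map_smul, LinearMap.smul_apply, smul_eq_mul, mul_eq_zero] at h'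
    exact h'.resolve_left ht
  exact hωnd.1 _ hzero

set_option maxHeartbeats 3200000 in
/-- **The upper corner `E𝔏(1−E)` has no element of rank `2`** (minimal raising rank `3`, `dim range B = 3`): a Levi `Z ∈ 𝔥_ℂ`
killing `range B` and mapping `P` into `range B`, with `dim Z(P) ≤ 2`, has `dim Z(P) ≤ 1`.
[cite: MoonenZarhin1999LowDim, §2 (2.3)–(2.5)] [cite: Deligne1982HodgeCycles, I §3 Prop. 3.4, Prop. 3.6] -/
theorem WeightOnePeirce.upperCorner_finrank_le_one (H : HodgeStructure V n) (ψ : H.Polarization) (hn : n = 1)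
    (heff : H.IsEffective)
    {B C : Module.End ℂ (ℂ ⊗[ℚ] V)} (hB : B ∈ H.hodgeLieC) (hB0 : B ≠ 0) (hBP : ∀ p ∈ H.piece 1 0, B p = 0)
    (hBim : ∀ v, B v ∈ H.piece 1 0) (hC : ∀ v, C v = conj (B (conj v)))
    (hmin : ∀ B' ∈ H.hodgeLieC, B' ≠ 0 → (∀ p ∈ H.piece 1 0, B' p = 0) → (∀ v, B' v ∈ H.piece 1 0) →
      Module.finrank ℂ (LinearMap.range B) ≤ Module.finrank ℂ (LinearMap.range B'))
    (h3 : Module.finrank ℂ (LinearMap.range B) = 3)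
    {Z : Module.End ℂ (ℂ ⊗[ℚ] V)} (hZ : Z ∈ H.hodgeLieC) (hZP : ∀ p ∈ H.piece 1 0, Z p ∈ H.piece 1 0)
    (hZQ : ∀ q ∈ H.piece 0 1, Z q ∈ H.piece 0 1) (hZB : ∀ v, Z (B v) = 0)
    (hZU : ∀ p ∈ H.piece 1 0, Z p ∈ LinearMap.range B)
    (hk : Module.finrank ℂ ((H.piece 1 0).map Z) ≤ 2) : Module.finrank ℂ ((H.piece 1 0).map Z) ≤ 1 := by
  classical
  have hspan : H.hodgeLieC = spanC H.hodgeLie := hodgeLieC_eq_spanC H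
  have hC𝔊 : C ∈ H.hodgeLieC := by
    rw [hspan] at hB ⊢
    exact conjOp_mem_spanC hB hC
  have hnd := WeightOnePeirce.form_conjOp_nondegenerate_on_range H ψ hn heff hB hB0 hBP hBim hC hmin
  subst hn
  obtain ⟨hCQ, hCim, -, -⟩ := SymplecticThetaTen.conjOp_raise (P := H.piece 1 0) (Q := H.piece 0 1)
    (fun x hx => conj_mem_piece H hx) (fun x hx => conj_mem_piece H hx) hBP hBim hC
  have hZZ : ∀ p ∈ H.piece 1 0, Z (Z p) = 0 := fun p hp => by
    obtain ⟨w, hw⟩ := hZU p hp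
    rw [← hw, hZB]
  exact WeightOnePeirce.corner_finrank_le_one H ψ rfl heff hmin (by omega) hC𝔊 hCQ hCim h3 hnd hZ hZP hZQ hZZ hZU hk

end HodgeStructure

end Literature.AlgebraicGeometry.Motives
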